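import Summits.ValiantsHypothesis.ValiantsHypothesis.Theorems.MonotoneRestorationOrbitCompressionQPExtraction
import Summits.ValiantsHypothesis.ValiantsHypothesis.Theorems.MonotoneRestorationMonotoneRestorationQPZetaPatterns
import Literature.Computability.AlgebraicComplexity.SymmetricOrbitCircuitEval
import HarnessLib

/-!
# Route MonotoneRestoration — aside `OrbitCompressionQP` (stmt-ValiantsHypothesis-18332): ONE-SORTED ζ-P
# and the aside in ONE-SORTED EXPRESSION currency

THEOREM ζ-P (`Theorems.zeta_symmetric_patternExpr`: bipartite labelled pattern expressions of
quasi-polynomial length and polylog labels are square-symmetric circuits of quasi-polynomial size) copied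
to the ONE-SORTED algebra `DiPatternExpr` (an edge `a b` is the pull-back of the scaled input family along
`y ↦ (y a, y b)`, loops included; summing out a label is a fibre sum), and the consequences for the aside:

* `dizeta_symmetric_patternExpr` / `_close` — a one-sorted expression with `k` labels and `|e|` operations
  is computed by a square-symmetric circuit on `≤ |e| · (2n² + 4 n^k + 5) (+1)` gates;
* `orbitCompressionQP_of_diCompression` — **the aside FOLLOWS from ONE-SORTED EXPRESSION COMPRESSION**:
  "every matrix-symmetric `VP` family presented from some `n₀` on by closed one-sorted expressions with
  polylog labels (any length) is so presented with quasi-polynomial LENGTH" implies `OrbitCompressionQP`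
  (extraction `OrbitSupport.diNarrow_of_qpOrbitFamily` + one-sorted ζ-P; small `n` absorbed in the
  constant by the orbit circuit);
* `diCircuitForm_of_orbitCompressionQP` — and the aside implies the circuit form of that compression
  (one-sorted narrow from `n₀` ⇒ qp SIZE), by `NarrowToOrbit.qpOrbit_of_diNarrowExpression`'s mechanism.

So the line `expression_compression` can be re-registered verbatim in the one-sorted algebra, where its
first stub is a THEOREM (`diNarrow_of_qpOrbitFamily`) and the second is the honest open content.  Helper
file (`--supports stmt-ValiantsHypothesis-18332`); def-free; nothing here is a named fact.
-/

noncomputable section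

open scoped Classical

-- `Summit.ValiantsHypothesis.ValiantsHypothesis.…` is the tree's single-conjunct layout (Sub = Summit).
set_option linter.dupNamespace false

namespace Summit.ValiantsHypothesis.ValiantsHypothesis.Theorems

namespace OrbitSupport

open Literature.Computability.AlgebraicComplexity MvPolynomial DiPatternExpr

/-! ### One-sorted ζ-P -/

/-- The fibre of the projection forgetting label `a` through `ℓ` is the set of `ℓ[a := v]`. [folklore] -/
theorem dizeta_fibre {k n : ℕ} (a : Fin k) (ℓ : Fin k → Fin n) :
    (Finset.univ.filter fun y : Fin k → Fin n =>
        (fun b : {b : Fin k // b ≠ a} => y b.1) = fun b : {b : Fin k // b ≠ a} => ℓ b.1) =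
      Finset.univ.image fun v : Fin n => Function.update ℓ a v := by
  ext y
  simp only [Finset.mem_filter, Finset.mem_univ, true_and, Finset.mem_image]
  constructor
  · intro h
    refine ⟨y a, ?_⟩
    funext b
    by_cases hb : b = a
    · subst hb; simp
    · rw [Function.update_of_ne hb]
      exact (congrFun h ⟨b, hb⟩).symm
  · rintro ⟨v, rfl⟩
    funext b
    exact Function.update_of_ne b.2 v ℓ

/-- **ONE-SORTED ζ-P.**  For `1 ≤ n`, every one-sorted labelled pattern expression `e` with `k` labels is
computed — as the output family `ℓ ↦ value n e ℓ` under the diagonal action — by a square-symmetric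
circuit on at most `|e| · (2n² + 4 n^k + 5)` gates. [cite: DawarPagoSeppelt2025, §5 (proof of Thm 5.3)] -/
theorem dizeta_symmetric_patternExpr {R : Type} [CommSemiring R] {k n : ℕ} [NeZero n]
    (e : DiPatternExpr R k) :
    ∃ (G : Type) (_ : Fintype G) (C : LabelledArithCircuit R (Fin n × Fin n) (Fin k → Fin n) G),
      C.IsSymmetric (Equiv.Perm (Fin n)) ∧
      (∀ ℓ, C.eval (C.output ℓ) = e.value n ℓ) ∧
      Fintype.card G ≤ e.length * (2 * (n * n) + 4 * n ^ k + 5) := by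
  have hN : Fintype.card (Fin k → Fin n) = n ^ k := by simp
  have hn1 : 1 ≤ n := Nat.one_le_iff_ne_zero.mpr (NeZero.ne n)
  induction e with
  | edge a b =>
    obtain ⟨G₁, i₁, C₁, h₁, hev₁, hc₁⟩ := LabelledArithCircuit.exists_scaledInputs
      (K := R) (X := Fin n × Fin n) (Equiv.Perm (Fin n)) 1
    obtain ⟨G, inst, C, hC, hev, hc⟩ := h₁.exists_pullback
      (fun y : Fin k → Fin n => (y a, y b)) (fun σ y => rfl)
    refine ⟨G, inst, C, hC, fun ℓ => ?_, ?_⟩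
    · rw [hev, hev₁, map_one, one_mul]; rfl
    · have hX : Fintype.card (Fin n × Fin n) = n * n := by simp
      rw [hN] at hc; rw [hX] at hc₁
      simp only [DiPatternExpr.length, one_mul]
      omega
  | const c =>
    obtain ⟨G, inst, C, hC, hev, hc⟩ := LabelledArithCircuit.exists_constOutputs (K := R)
      (Fin n × Fin n) (Γ := Equiv.Perm (Fin n)) (fun _ : Fin k → Fin n => c) (fun _ _ => rfl)
    refine ⟨G, inst, C, hC, fun ℓ => hev ℓ, ?_⟩
    rw [hN] at hc
    simp only [DiPatternExpr.length, one_mul]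
    omega
  | add e₁ e₂ ih₁ ih₂ =>
    obtain ⟨G₁, i₁, C₁, h₁, hev₁, hc₁⟩ := ih₁
    obtain ⟨G₂, i₂, C₂, h₂, hev₂, hc₂⟩ := ih₂
    obtain ⟨G₀, i₀, C₀, h₀, hinl, hinr, hc₀⟩ := h₁.exists_pairing h₂
    obtain ⟨G, inst, C, hC, hev, hc⟩ := h₀.exists_linCombOutputs C₀ 1 1
    refine ⟨G, inst, C, hC, fun ℓ => ?_, ?_⟩
    · rw [hev, hinl, hinr, hev₁, hev₂, map_one, one_mul, one_mul]; rfl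
    · rw [hN] at hc
      simp only [DiPatternExpr.length]
      nlinarith
  | mul e₁ e₂ ih₁ ih₂ =>
    obtain ⟨G₁, i₁, C₁, h₁, hev₁, hc₁⟩ := ih₁
    obtain ⟨G₂, i₂, C₂, h₂, hev₂, hc₂⟩ := ih₂
    obtain ⟨G₀, i₀, C₀, h₀, hinl, hinr, hc₀⟩ := h₁.exists_pairing h₂
    obtain ⟨G, inst, C, hC, hev, hc⟩ := h₀.exists_hadamard
    refine ⟨G, inst, C, hC, fun ℓ => ?_, ?_⟩
    · rw [hev, hinl, hinr, hev₁, hev₂]; rfl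
    · rw [hN] at hc
      simp only [DiPatternExpr.length]
      nlinarith
  | sumLabel a e ih =>
    obtain ⟨G₁, i₁, C₁, h₁, hev₁, hc₁⟩ := ih
    let p : (Fin k → Fin n) → ({b : Fin k // b ≠ a} → Fin n) := fun y b => y b.1
    have hp : ∀ (σ : Equiv.Perm (Fin n)) (y : Fin k → Fin n), p (σ • y) = σ • p y := fun σ y => rfl
    have hsurj : Function.Surjective p := by
      intro ℓ₀
      refine ⟨fun b => if h : b = a then 0 else ℓ₀ ⟨b, h⟩, ?_⟩
      funext b
      simp [p, dif_neg b.2]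
    obtain ⟨G₂, i₂, C₂, h₂, hev₂, hc₂⟩ := h₁.exists_fibreSum p hp hsurj
    obtain ⟨G, inst, C, hC, hev, hc⟩ := h₂.exists_pullback p hp
    refine ⟨G, inst, C, hC, fun ℓ => ?_, ?_⟩
    · rw [hev, hev₂, DiPatternExpr.value_sumLabel]
      rw [show (Finset.univ.filter fun y => p y = p ℓ) =
          Finset.univ.image fun v : Fin n => Function.update ℓ a v from dizeta_fibre a ℓ]
      rw [Finset.sum_image fun v _ w _ hvw => by
        have := congrFun hvw a
        simpa using this]
      exact Finset.sum_congr rfl fun v _ => hev₁ _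
    · have hc₂' : Fintype.card ({b : Fin k // b ≠ a} → Fin n) ≤ n ^ k := by
        simp only [Fintype.card_fun, Fintype.card_fin]
        exact Nat.pow_le_pow_right hn1 ((Fintype.card_subtype_le _).trans (by simp))
      rw [hN] at hc
      simp only [DiPatternExpr.length]
      nlinarith

/-- **One-sorted ζ-P, closed form**: `Σ_ℓ value n e ℓ` on one more gate. [cite: DawarPagoSeppelt2025, §5] -/
theorem dizeta_symmetric_patternExpr_close {R : Type} [CommSemiring R] {k n : ℕ} [NeZero n]
    [MulAction (Equiv.Perm (Fin n)) Unit] (e : DiPatternExpr R k) :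
    ∃ (G : Type) (_ : Fintype G) (C : LabelledArithCircuit R (Fin n × Fin n) Unit G),
      C.IsSymmetric (Equiv.Perm (Fin n)) ∧ C.eval (C.output ()) = e.close n ∧
      Fintype.card G ≤ e.length * (2 * (n * n) + 4 * n ^ k + 5) + 1 := by
  obtain ⟨G₁, i₁, C₁, h₁, hev₁, hc₁⟩ := dizeta_symmetric_patternExpr (n := n) e
  obtain ⟨G, inst, C, hC, hev, hc⟩ := h₁.exists_sumOutputs
  refine ⟨G, inst, C, hC, ?_, hc.trans (Nat.add_le_add_right hc₁ 1)⟩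
  rw [hev, DiPatternExpr.close]
  exact Finset.sum_congr rfl fun ℓ _ => hev₁ ℓ

/-- Quasi-polynomial bookkeeping for one-sorted ζ-P (`2 ≤ n`... any `1 ≤ n`): the size bound at the
crux's scale. [folklore] -/
theorem dizeta_qp_bound {n k c L : ℕ} (hkl : n ^ k ≤ 2 ^ ((Nat.log 2 n + c) ^ c))
    (hlen : L ≤ 2 ^ ((Nat.log 2 n + c) ^ c)) :
    L * (2 * (n * n) + 4 * n ^ k + 5) + 1 ≤ 12 * (n + 2) ^ 2 * 2 ^ (2 * (Nat.log 2 n + c) ^ c) := by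
  set Q := 2 ^ ((Nat.log 2 n + c) ^ c) with hQ
  have hQ1 : 1 ≤ Q := Nat.one_le_two_pow
  have h2 : 2 ^ (2 * (Nat.log 2 n + c) ^ c) = Q * Q := by rw [two_mul, pow_add]
  rw [h2]
  have hP : 4 ≤ (n + 2) ^ 2 := by
    have : 2 ≤ n + 2 := by omega
    calc 4 = 2 ^ 2 := by norm_num
      _ ≤ (n + 2) ^ 2 := Nat.pow_le_pow_left this 2
  have hnn : n * n ≤ (n + 2) ^ 2 := by rw [pow_two]; exact Nat.mul_le_mul (by omega) (by omega)
  set P := (n + 2) ^ 2 with hPdef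
  have hQQ : Q ≤ Q * Q := by nlinarith
  calc L * (2 * (n * n) + 4 * n ^ k + 5) + 1
      ≤ Q * (2 * P + 4 * Q + 5) + 1 := by
        have := Nat.mul_le_mul hlen (show 2 * (n * n) + 4 * n ^ k + 5 ≤ 2 * P + 4 * Q + 5 by omega)
        omega
    _ = 2 * P * Q + 4 * (Q * Q) + 5 * Q + 1 := by ring
    _ ≤ 2 * P * (Q * Q) + P * (Q * Q) + 5 * P * (Q * Q) + P * (Q * Q) := by
        have e1 := Nat.mul_le_mul_left (2 * P) hQQ
        have e2 : 4 * (Q * Q) ≤ P * (Q * Q) := Nat.mul_le_mul_right _ hP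
        have e3 : 5 * Q ≤ 5 * P * (Q * Q) := by nlinarith
        have e4 : 1 ≤ P * (Q * Q) := by nlinarith
        omega
    _ = 9 * P * (Q * Q) := by ring
    _ ≤ 12 * P * (Q * Q) := by nlinarith

/-! ### The aside in one-sorted expression currency -/

/-- **`OrbitCompressionQP` FOLLOWS FROM ONE-SORTED EXPRESSION COMPRESSION.**  If every matrix-symmetric `VP`
family that is presented, from some `n₀` on, by closed one-sorted expressions with `n^{k_n} ≤
2^{(log₂ n + c)^c}` labels (any length) is so presented, from some `n₀'` on, with LENGTH `≤ 2^{(log₂ n + c')^{c'}}`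
as well, then `OrbitCompressionQP` holds. [folklore] -/
theorem orbitCompressionQP_of_diCompression
    (h : ∀ f : (n : ℕ) → MvPolynomial (Fin n × Fin n) ℂ,
      (∀ (n : ℕ) (σ τ : Equiv.Perm (Fin n)),
        MvPolynomial.rename (fun p : Fin n × Fin n => (σ p.1, τ p.2)) (f n) = f n) →
      IsVPFamily f →
      (∃ c n₀ : ℕ, ∀ n : ℕ, n₀ ≤ n → ∃ (k : ℕ) (e : DiPatternExpr ℂ k),
        n ^ k ≤ 2 ^ ((Nat.log 2 n + c) ^ c) ∧ e.close n = f n) →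
      ∃ c n₀ : ℕ, ∀ n : ℕ, n₀ ≤ n → ∃ (k : ℕ) (e : DiPatternExpr ℂ k),
        n ^ k ≤ 2 ^ ((Nat.log 2 n + c) ^ c) ∧ e.length ≤ 2 ^ ((Nat.log 2 n + c) ^ c) ∧
        e.close n = f n) :
    Theses.MonotoneRestoration.OrbitCompressionQP := by
  intro f hsymm hVP horb
  obtain ⟨c, n₀, hc⟩ := h f hsymm hVP (diNarrow_of_qpOrbitFamily f horb)
  have hinv : ∀ (n : ℕ) (σ : Equiv.Perm (Fin n)),
      MvPolynomial.rename (fun pq : Fin n × Fin n => σ • pq) (f n) = f n := fun n σ => hsymm n σ σ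
  -- a symmetric circuit at every `n`, to absorb `n < n₀` in the constant
  have hsmall : ∀ n : ℕ, ∃ M : ℕ, ∃ (G : Type) (_ : Fintype G)
      (C : LabelledArithCircuit ℂ (Fin n × Fin n) Unit G),
      C.IsSymmetric (Equiv.Perm (Fin n)) ∧ C.eval (C.output ()) = f n ∧ Fintype.card G ≤ M := by
    intro n
    obtain ⟨G, inst, C, hC, hev, -⟩ := OrbitCircuit.exists_symmetric_circuit_of_invariant (f n) (hinv n)
    exact ⟨Fintype.card G, G, inst, C, hC, hev, le_rfl⟩
  choose M hM using hsmall
  obtain ⟨c₃, hc₃⟩ := zeta_poly_mul_qp_le 12 2 c 2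
  set c' : ℕ := max (max c₃ 1) ((Finset.range (max n₀ 1)).sup M) with hc'
  refine ⟨c', fun n => ?_⟩
  rcases Nat.lt_or_ge n (max n₀ 1) with hn | hn
  · obtain ⟨G, inst, C, hC, hev, hcard⟩ := hM n
    refine ⟨G, inst, C, hC, hev, hcard.trans ?_⟩
    have h1 : M n ≤ c' := (Finset.le_sup (f := M) (Finset.mem_range.2 hn)).trans (le_max_right _ _)
    calc M n ≤ c' := h1
      _ ≤ (Nat.log 2 n + c') ^ c' := by
          have h0 : 0 < c' := lt_of_lt_of_le Nat.one_pos ((le_max_right _ _).trans (le_max_left _ _))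
          exact (Nat.le_add_left c' _).trans (Nat.le_self_pow h0.ne' _)
      _ ≤ 2 ^ ((Nat.log 2 n + c') ^ c') := Nat.lt_two_pow_self.le
  · have hn1 : 1 ≤ n := le_trans (le_max_right _ _) hn
    haveI : NeZero n := ⟨by omega⟩
    obtain ⟨k, e, hk, hlen, hclose⟩ := hc n (le_trans (le_max_left _ _) hn)
    obtain ⟨G, inst, C, hC, hev, hcard⟩ := dizeta_symmetric_patternExpr_close (n := n) e
    refine ⟨G, inst, C, hC, by rw [hev, hclose], hcard.trans ((dizeta_qp_bound hk hlen).trans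
      ((hc₃ n).trans (OrbitCompressionForms.qp_mono ((le_max_left _ _).trans (le_max_left _ _)))))⟩

/-- **Conversely, the aside gives the circuit form of one-sorted compression**: every matrix-symmetric
`VP` family presented from some `n₀` on by closed one-sorted expressions with polylog labels (any length)
has square-symmetric circuits of quasi-polynomial SIZE. [folklore] -/
theorem diCircuitForm_of_orbitCompressionQP (h : Theses.MonotoneRestoration.OrbitCompressionQP) :
    ∀ f : (n : ℕ) → MvPolynomial (Fin n × Fin n) ℂ,
      (∀ (n : ℕ) (σ τ : Equiv.Perm (Fin n)),
        MvPolynomial.rename (fun p : Fin n × Fin n => (σ p.1, τ p.2)) (f n) = f n) →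
      IsVPFamily f →
      (∃ c n₀ : ℕ, ∀ n : ℕ, n₀ ≤ n → ∃ (k : ℕ) (e : DiPatternExpr ℂ k),
        n ^ k ≤ 2 ^ ((Nat.log 2 n + c) ^ c) ∧ e.close n = f n) →
      ∃ c : ℕ, ∀ n : ℕ, ∃ (G : Type) (_ : Fintype G)
        (C : LabelledArithCircuit ℂ (Fin n × Fin n) Unit G),
        C.IsSymmetric (Equiv.Perm (Fin n)) ∧ C.eval (C.output ()) = f n ∧
          Fintype.card G ≤ 2 ^ ((Nat.log 2 n + c) ^ c) := by
  rintro f hsymm hVP ⟨c, n₀, hc⟩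
  refine h f hsymm hVP ?_
  have hinv : ∀ (n : ℕ) (σ : Equiv.Perm (Fin n)),
      MvPolynomial.rename (fun pq : Fin n × Fin n => σ • pq) (f n) = f n := fun n σ => hsymm n σ σ
  have hsmall : ∀ n : ℕ, ∃ M : ℕ, ∃ (G : Type) (_ : Fintype G)
      (C : LabelledArithCircuit ℂ (Fin n × Fin n) Unit G),
      C.IsSymmetric (Equiv.Perm (Fin n)) ∧ C.eval (C.output ()) = f n ∧
        C.orbitSize (Equiv.Perm (Fin n)) ≤ M := by
    intro n
    obtain ⟨G, inst, C, hC, hev, -⟩ := OrbitCircuit.exists_symmetric_circuit_of_invariant (f n) (hinv n)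
    exact ⟨C.orbitSize (Equiv.Perm (Fin n)), G, inst, C, hC, hev, le_rfl⟩
  choose M hM using hsmall
  set c' : ℕ := max (c + 5) ((Finset.range (max n₀ 2)).sup M) with hc'
  refine ⟨c', fun n => ?_⟩
  rcases Nat.lt_or_ge n (max n₀ 2) with hn | hn
  · obtain ⟨G, inst, C, hC, hev, horb⟩ := hM n
    refine ⟨G, inst, C, hC, hev, horb.trans ?_⟩
    have h1 : M n ≤ c' := (Finset.le_sup (f := M) (Finset.mem_range.2 hn)).trans (le_max_right _ _)
    calc M n ≤ c' := h1
      _ ≤ (Nat.log 2 n + c') ^ c' := by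
          have h0 : 0 < c' := lt_of_lt_of_le (by omega) (le_max_left _ _)
          exact (Nat.le_add_left c' _).trans (Nat.le_self_pow h0.ne' _)
      _ ≤ 2 ^ ((Nat.log 2 n + c') ^ c') := Nat.lt_two_pow_self.le
  · obtain ⟨k, e, hk, hclose⟩ := hc n (le_trans (le_max_left _ _) hn)
    obtain ⟨G, inst, C, hC, hev, horb⟩ := NarrowToOrbit.exists_symmetric_orbit_le_of_diClose n e
    refine ⟨G, inst, C, hC, hev.trans hclose, horb.trans ?_⟩
    have h2 : 2 ≤ n := le_trans (le_max_right _ _) hn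
    exact (NarrowToOrbit.orbit_arith h2 hk).trans (OrbitCompressionForms.qp_mono (by
      refine le_trans ?_ (le_max_left _ _); omega))

end OrbitSupport

end Summit.ValiantsHypothesis.ValiantsHypothesis.Theorems

end
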